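import Mathlib
import HarnessLib
import Summits.Ventures.LatticeQCDFlow.Scaling.AcceptanceEssEightNinthsIntegral

/-!
# LatticeQCDFlow / Scaling — the `acc ≥ (8/9)·ESS` law on a general space, III: the inequality as
# an IDENTITY with two explicit deficits, and the EXACT EXCESS over `(8/9)Z³/W`

HONEST FRAMING: exact (Metropolis-corrected) sampling algorithms for lattice gauge theory;
figures of merit are autocorrelation/cost numbers at stated couplings and volumes; no
continuum-physics claim.

Venture `LatticeQCDFlow` (cell pub-lqcd), topic `Scaling`; FANOUT row 3 (`s0-u1-a`, S0-B
implementation A, GEN-12).  NEW WORK of the cell, not a published result; NO definition is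
introduced.  Part I (`Scaling/AcceptanceEssEightNinthsIntegral`, imported; setting, notation and the
half-line lemmas reused) proved the layer-cake INEQUALITY
`2c·∫bρ ≤ ∫∫ min(b, b′)ρρ′ + l·∫b²ρ + c³/(3l)` and from it `(8/9)Z³/W ≤ ∫∫ min(b, b′)ρρ′`.  Here
the same chain is run with NO inequality step: the two places where Part I discarded something —
one square `2Sg ≤ S² + g²` on the half-line and the tangent `∫₀^b (c − lt)₊ ≥ cb − lb²/2` — are
replaced by identities carrying explicit nonnegative deficits (everything additive in `ℝ≥0∞`;
`ν =` Lebesgue measure on `(0, ∞)`, `S(t) = ∫ 𝟙(t < b)ρ dμ` the weight's survival mass,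
`g(t) = (c − l t)₊` the tent).  The companion `Scaling/AcceptanceEssEightNinthsRigidity` reads off
the EQUALITY CASE (listed NOT CLAIMED since GEN-9).

* `lintegral_indicator_Iio_tent_add`, `two_mul_tentPrimitive_add` — the tent primitive EXACTLY:
  `∫₀^s (c − lt)₊ dt + l s²/2 = c s + (l/2)·(s − c/l)₊²`;
* `sq_add_sq_eq_two_mul_add` — `u² + v² = 2uv + ((u ∸ v)² + (v ∸ u)²)` in `ℝ≥0∞`;
* **`overlap_add_eq_deficits`** — THE IDENTITY, for every `c ≥ 0`, `l > 0`:
  `∫∫ min(b,b′)ρρ′ + c³/(3l) + l·∫b²ρ = 2c·∫bρ + l·∫ (b − c/l)₊² ρ + ∫ ((S ∸ g)² + (g ∸ S)²) dν`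
  (Part I's inequality says the last two terms are `≥ 0`);
* **`overlap_eq_eight_ninths_add_excess`** — at the optimal tent (`c = 4Z²/(3W)`, `l = 8Z³/(9W²)`,
  `c/l = 3W/(2Z)`; `Z = ∫bρ`, `W = ∫b²ρ` finite positive):
  `∫∫ min(b,b′)ρρ′ = (8/9)Z³/W + l·∫ (b − 3W/(2Z))₊² ρ + ∫ ((S ∸ g)² + (g ∸ S)²) dν` EXACTLY.

Reading (value-free): the slack in `acc ≥ (8/9)·ESS` of an exact flow sampler is exactly an `L²`
distance of the weight's survival function from a tent plus a second-moment penalty on weights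
above `3W/(2Z)`.  NOT CLAIMED: any acceptance or ESS of ours; nothing re-scored.
-/

namespace Summit.Ventures.LatticeQCDFlow.Theory2

open MeasureTheory ENNReal Set Filter

/-! ### Half-line: the tent primitive exactly -/

section HalfLine

/-- **The tent primitive, exactly**: for `s, c ≥ 0`, `l > 0`,
`∫_{(0,∞)} 𝟙(t < s)·(c − l t)₊ dt + l s²/2 = c s + (l/2)·(s − c/l)₊²`
(below the kink `s ≤ c/l` the primitive is `c s − l s²/2`, above it freezes at `c²/(2l)`). [ours] -/
theorem lintegral_indicator_Iio_tent_add {s c l : ℝ} (hs : 0 ≤ s) (hc : 0 ≤ c) (hl : 0 < l) :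
    (∫⁻ t, (Iio s).indicator (1 : ℝ → ℝ≥0∞) t * ENNReal.ofReal (c - l * t)
        ∂(volume.restrict (Ioi 0))) + ENNReal.ofReal (l * s ^ 2 / 2)
      = ENNReal.ofReal (c * s) + ENNReal.ofReal (l / 2 * max (s - c / l) 0 ^ 2) := by
  set m : ℝ := min s (c / l) with hm
  have hm0 : 0 ≤ m := le_min hs (div_nonneg hc hl.le)
  have hms : m ≤ s := min_le_left _ _
  have hmc : m ≤ c / l := min_le_right _ _
  -- the integrand is the indicator of `(0, m)` applied to `ofReal (c − l t)`
  have e : (fun t : ℝ => (Iio s).indicator (1 : ℝ → ℝ≥0∞) t * ENNReal.ofReal (c - l * t))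
      = (Iio m).indicator fun t => ENNReal.ofReal (c - l * t) := by
    funext t
    simp only [Set.indicator_apply, mem_Iio, Pi.one_apply]
    by_cases h1 : t < m
    · rw [if_pos (h1.trans_le hms), if_pos h1, one_mul]
    · rw [if_neg h1]
      by_cases h2 : t < s
      · rw [if_pos h2, one_mul]
        have hct : c / l ≤ t := by
          rcases min_choice s (c / l) with h | h
          · exact absurd h2 (by rw [← h, ← hm]; exact h1)
          · rw [← h, ← hm]; exact not_lt.1 h1
        exact ENNReal.ofReal_of_nonpos (by nlinarith [(div_le_iff₀ hl).1 hct])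
      · rw [if_neg h2, zero_mul]
  rw [e, lintegral_indicator measurableSet_Iio, Measure.restrict_restrict measurableSet_Iio,
    Iio_inter_Ioi]
  have hint : IntegrableOn (fun t : ℝ => c - l * t) (Ioo 0 m) volume :=
    ((continuous_const.sub (continuous_const.mul continuous_id)).integrableOn_Icc).mono_set
      Ioo_subset_Icc_self
  have hnn : 0 ≤ᵐ[volume.restrict (Ioo 0 m)] fun t : ℝ => c - l * t := by
    refine (ae_restrict_iff' measurableSet_Ioo).2 (Eventually.of_forall fun t ht => ?_)
    have htc : t ≤ c / l := ht.2.le.trans hmc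
    have htl : t * l ≤ c := (le_div_iff₀ hl).1 htc
    show (0 : ℝ) ≤ c - l * t
    linarith [mul_comm t l]
  rw [← ofReal_integral_eq_lintegral_ofReal hint hnn]
  have hval : ∫ t in Ioo 0 m, (c - l * t) = c * m - l * m ^ 2 / 2 := by
    rw [← integral_Ioc_eq_integral_Ioo, ← intervalIntegral.integral_of_le hm0,
      intervalIntegral.integral_sub, intervalIntegral.integral_const,
      intervalIntegral.integral_const_mul, integral_id]
    · simp only [smul_eq_mul]
      ring
    · exact continuous_const.intervalIntegrable _ _
    · exact (continuous_const.mul continuous_id).intervalIntegrable _ _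
  rw [hval]
  have hprim : 0 ≤ c * m - l * m ^ 2 / 2 := by
    have : l * m ≤ c := by rwa [← le_div_iff₀' hl]
    nlinarith
  rw [← ENNReal.ofReal_add hprim (by positivity), ← ENNReal.ofReal_add (by positivity)
    (by positivity)]
  congr 1
  rcases le_total s (c / l) with h | h
  · have hm' : m = s := min_eq_left h
    rw [hm', max_eq_right (by linarith), zero_pow two_ne_zero, mul_zero, add_zero]
    ring
  · have hm' : m = c / l := min_eq_right h
    rw [hm', max_eq_left (by linarith)]
    field_simp
    ring

/-- **Pointwise tent identity**: `2·∫₀^{s} (c − lt)₊ dt + l·s² = 2c·s + l·(s − c/l)₊²`. [ours] -/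
theorem two_mul_tentPrimitive_add {s c l : ℝ} (hs : 0 ≤ s) (hc : 0 ≤ c) (hl : 0 < l) :
    2 * (∫⁻ t, (Iio s).indicator (1 : ℝ → ℝ≥0∞) t * ENNReal.ofReal (c - l * t)
        ∂(volume.restrict (Ioi 0))) + ENNReal.ofReal l * ENNReal.ofReal (s ^ 2)
      = 2 * ENNReal.ofReal c * ENNReal.ofReal s
        + ENNReal.ofReal l * ENNReal.ofReal (max (s - c / l) 0 ^ 2) := by
  have h := lintegral_indicator_Iio_tent_add hs hc hl
  have h2 : (2 : ℝ≥0∞) = ENNReal.ofReal 2 := by norm_num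
  have e1 : ENNReal.ofReal l * ENNReal.ofReal (s ^ 2) = 2 * ENNReal.ofReal (l * s ^ 2 / 2) := by
    rw [← ENNReal.ofReal_mul hl.le, h2, ← ENNReal.ofReal_mul (by norm_num : (0:ℝ) ≤ 2)]
    congr 1; ring
  have e2 : 2 * ENNReal.ofReal c * ENNReal.ofReal s = 2 * ENNReal.ofReal (c * s) := by
    rw [mul_assoc, ← ENNReal.ofReal_mul hc]
  have e3 : ENNReal.ofReal l * ENNReal.ofReal (max (s - c / l) 0 ^ 2)
      = 2 * ENNReal.ofReal (l / 2 * max (s - c / l) 0 ^ 2) := by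
    rw [← ENNReal.ofReal_mul hl.le, h2, ← ENNReal.ofReal_mul (by norm_num : (0:ℝ) ≤ 2)]
    congr 1; ring
  rw [e1, e2, e3, ← mul_add, ← mul_add, h]

end HalfLine

/-! ### `u² + v² = 2uv + (u ∸ v)² + (v ∸ u)²` in `ℝ≥0∞` -/

/-- **One square, exactly, in `ℝ≥0∞`**: `u·u + v·v = 2(u·v) + ((u ∸ v)² + (v ∸ u)²)` (truncated
subtraction; both sides are `⊤` as soon as one of `u, v` is). [folklore] -/
theorem sq_add_sq_eq_two_mul_add (u v : ℝ≥0∞) :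
    u * u + v * v = 2 * (u * v) + ((u - v) ^ 2 + (v - u) ^ 2) := by
  wlog h : u ≤ v generalizing u v
  · have h' := this v u (le_of_not_ge h)
    rw [add_comm (u * u), mul_comm u v, add_comm ((u - v) ^ 2)]
    exact h'
  rcases eq_or_ne u ⊤ with rfl | hu
  · have hv : v = ⊤ := top_le_iff.mp h
    subst hv
    simp
  obtain ⟨d, rfl⟩ := exists_add_of_le h
  rw [tsub_eq_zero_of_le h, ENNReal.add_sub_cancel_left hu, zero_pow two_ne_zero, zero_add]
  ring

/-! ### The identity with deficits -/

section Core

variable {X : Type*} [MeasurableSpace X] {μ : Measure X} [SFinite μ] {b : X → ℝ} {ρ : X → ℝ≥0∞}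

/-- **THE IDENTITY WITH DEFICITS.**  For a measurable weight `b ≥ 0`, a measurable density `ρ`
on an s-finite measure space and reals `c ≥ 0`, `l > 0`, with `S(t) = ∫ 𝟙(t < b) ρ dμ`,
`g(t) = (c − lt)₊` and `ν =` Lebesgue measure on `(0, ∞)`:
`∫∫ min(b x, b y) ρ x ρ y + c³/(3l) + l·∫ b²ρ = 2c·∫ bρ + l·∫ (b − c/l)₊² ρ + ∫ ((S ∸ g)² + (g ∸ S)²) dν`.
(Layer cake: `∫∫ min(b,b′)ρρ′ = ∫ S²`, `∫ S g = ∫ ρ(x) ∫₀^{b x} g`, `∫ g² = c³/(3l)`; then one exact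
square and the exact tent primitive.) [ours] -/
theorem overlap_add_eq_deficits (hb : Measurable b) (hb0 : ∀ x, 0 ≤ b x) (hρ : Measurable ρ)
    {c l : ℝ} (hc : 0 ≤ c) (hl : 0 < l) :
    (∫⁻ x, ∫⁻ y, ENNReal.ofReal (min (b x) (b y)) * ρ x * ρ y ∂μ ∂μ)
        + ENNReal.ofReal (c ^ 3 / (3 * l))
        + ENNReal.ofReal l * (∫⁻ x, ENNReal.ofReal (b x ^ 2) * ρ x ∂μ)
      = 2 * ENNReal.ofReal c * (∫⁻ x, ENNReal.ofReal (b x) * ρ x ∂μ)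
        + ENNReal.ofReal l * (∫⁻ x, ENNReal.ofReal (max (b x - c / l) 0 ^ 2) * ρ x ∂μ)
        + ∫⁻ t, (((∫⁻ x, (Iio (b x)).indicator (1 : ℝ → ℝ≥0∞) t * ρ x ∂μ)
              - ENNReal.ofReal (c - l * t)) ^ 2
            + (ENNReal.ofReal (c - l * t)
              - ∫⁻ x, (Iio (b x)).indicator (1 : ℝ → ℝ≥0∞) t * ρ x ∂μ) ^ 2)
            ∂(volume.restrict (Ioi 0)) := by
  set ν : Measure ℝ := volume.restrict (Ioi 0) with hν
  -- measurability bookkeeping (as in Part I)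
  have hI : Measurable fun p : X × ℝ => (Iio (b p.1)).indicator (1 : ℝ → ℝ≥0∞) p.2 :=
    measurable_indicator_Iio_uncurry hb
  have hIx : ∀ x, Measurable fun t : ℝ => (Iio (b x)).indicator (1 : ℝ → ℝ≥0∞) t := fun x =>
    measurable_one.indicator measurableSet_Iio
  have hF : Measurable fun p : X × ℝ => (Iio (b p.1)).indicator (1 : ℝ → ℝ≥0∞) p.2 * ρ p.1 :=
    hI.fun_mul (hρ.comp measurable_fst)
  have hFt : ∀ t, Measurable fun x => (Iio (b x)).indicator (1 : ℝ → ℝ≥0∞) t * ρ x := fun t =>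
    hF.comp (measurable_id.prodMk measurable_const)
  have hg : Measurable fun t : ℝ => ENNReal.ofReal (c - l * t) :=
    ((measurable_id.const_mul l).const_sub c).ennreal_ofReal
  have hS : Measurable fun t => ∫⁻ x, (Iio (b x)).indicator (1 : ℝ → ℝ≥0∞) t * ρ x ∂μ :=
    hF.lintegral_prod_left'
  have hG : Measurable fun x =>
      ∫⁻ t, (Iio (b x)).indicator (1 : ℝ → ℝ≥0∞) t * ENNReal.ofReal (c - l * t) ∂ν :=
    (hI.fun_mul (hg.comp measurable_snd)).lintegral_prod_right'
  -- Step A: the overlap is `∫ S²`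
  have hA : ∫⁻ x, ∫⁻ y, ENNReal.ofReal (min (b x) (b y)) * ρ x * ρ y ∂μ ∂μ
      = ∫⁻ t, (∫⁻ x, (Iio (b x)).indicator (1 : ℝ → ℝ≥0∞) t * ρ x ∂μ)
          * (∫⁻ x, (Iio (b x)).indicator (1 : ℝ → ℝ≥0∞) t * ρ x ∂μ) ∂ν := by
    have inner : ∀ x, ∫⁻ y, ENNReal.ofReal (min (b x) (b y)) * ρ x * ρ y ∂μ
        = ∫⁻ t, ((Iio (b x)).indicator (1 : ℝ → ℝ≥0∞) t * ρ x)
            * ∫⁻ y, (Iio (b y)).indicator (1 : ℝ → ℝ≥0∞) t * ρ y ∂μ ∂ν := by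
      intro x
      have e1 : ∀ y, ENNReal.ofReal (min (b x) (b y)) * ρ x * ρ y
          = ∫⁻ t, ((Iio (b x)).indicator (1 : ℝ → ℝ≥0∞) t * ρ x)
              * ((Iio (b y)).indicator (1 : ℝ → ℝ≥0∞) t * ρ y) ∂ν := by
        intro y
        rw [← lintegral_indicator_Iio_mul_indicator_Iio (b x) (b y),
          ← lintegral_mul_const _ ((hIx x).fun_mul (hIx y)),
          ← lintegral_mul_const _ (((hIx x).fun_mul (hIx y)).mul_const _)]
        exact lintegral_congr fun t => by ring
      simp_rw [e1]
      rw [lintegral_lintegral_swap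
        (((hF.comp (measurable_const.prodMk measurable_snd)).fun_mul hF).aemeasurable)]
      exact lintegral_congr fun t => by rw [lintegral_const_mul _ (hFt t)]
    simp_rw [inner]
    rw [lintegral_lintegral_swap ((hF.fun_mul (hS.comp measurable_snd)).aemeasurable)]
    exact lintegral_congr fun t => by rw [lintegral_mul_const _ (hFt t)]
  -- Step B: `∫ S g = ∫ ρ(x) G(x)`
  have hB : ∫⁻ t, (∫⁻ x, (Iio (b x)).indicator (1 : ℝ → ℝ≥0∞) t * ρ x ∂μ)
        * ENNReal.ofReal (c - l * t) ∂ν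
      = ∫⁻ x, (∫⁻ t, (Iio (b x)).indicator (1 : ℝ → ℝ≥0∞) t * ENNReal.ofReal (c - l * t) ∂ν)
          * ρ x ∂μ := by
    calc ∫⁻ t, (∫⁻ x, (Iio (b x)).indicator (1 : ℝ → ℝ≥0∞) t * ρ x ∂μ)
            * ENNReal.ofReal (c - l * t) ∂ν
        = ∫⁻ t, ∫⁻ x, (Iio (b x)).indicator (1 : ℝ → ℝ≥0∞) t * ρ x
            * ENNReal.ofReal (c - l * t) ∂μ ∂ν :=
          lintegral_congr fun t => by rw [lintegral_mul_const _ (hFt t)]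
      _ = ∫⁻ x, ∫⁻ t, (Iio (b x)).indicator (1 : ℝ → ℝ≥0∞) t * ρ x
            * ENNReal.ofReal (c - l * t) ∂ν ∂μ :=
          lintegral_lintegral_swap
            (((hF.comp measurable_swap).fun_mul (hg.comp measurable_fst)).aemeasurable)
      _ = ∫⁻ x, (∫⁻ t, (Iio (b x)).indicator (1 : ℝ → ℝ≥0∞) t * ENNReal.ofReal (c - l * t) ∂ν)
            * ρ x ∂μ := by
          refine lintegral_congr fun x => ?_
          rw [← lintegral_mul_const _ ((hIx x).fun_mul hg)]
          exact lintegral_congr fun t => by ring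
  -- `∫ g² = c³/(3l)` (Part I)
  have hgg : ∫⁻ t, ENNReal.ofReal (c - l * t) * ENNReal.ofReal (c - l * t) ∂ν
      = ENNReal.ofReal (c ^ 3 / (3 * l)) := by
    rw [← lintegral_tent_sq hc hl]
    exact lintegral_congr fun t => by ring
  -- Step C (exact): integrate the pointwise tent identity against `ρ`
  have hb2 : Measurable fun x => ENNReal.ofReal (b x ^ 2) * ρ x :=
    (hb.pow_const 2).ennreal_ofReal.fun_mul hρ
  have hE : Measurable fun x => ENNReal.ofReal (max (b x - c / l) 0 ^ 2) * ρ x :=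
    (((hb.sub_const _).max measurable_const).pow_const 2).ennreal_ofReal.fun_mul hρ
  have hC : 2 * (∫⁻ x, (∫⁻ t, (Iio (b x)).indicator (1 : ℝ → ℝ≥0∞) t * ENNReal.ofReal (c - l * t) ∂ν)
          * ρ x ∂μ) + ENNReal.ofReal l * ∫⁻ x, ENNReal.ofReal (b x ^ 2) * ρ x ∂μ
      = 2 * ENNReal.ofReal c * (∫⁻ x, ENNReal.ofReal (b x) * ρ x ∂μ)
        + ENNReal.ofReal l * ∫⁻ x, ENNReal.ofReal (max (b x - c / l) 0 ^ 2) * ρ x ∂μ := by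
    rw [← lintegral_const_mul _ (hG.fun_mul hρ), ← lintegral_const_mul _ hb2,
      ← lintegral_add_left ((hG.fun_mul hρ).const_mul _),
      ← lintegral_const_mul _ (hb.ennreal_ofReal.fun_mul hρ), ← lintegral_const_mul _ hE,
      ← lintegral_add_left ((hb.ennreal_ofReal.fun_mul hρ).const_mul _)]
    refine lintegral_congr fun x => ?_
    have h := two_mul_tentPrimitive_add (hb0 x) hc hl
    calc 2 * ((∫⁻ t, (Iio (b x)).indicator (1 : ℝ → ℝ≥0∞) t * ENNReal.ofReal (c - l * t) ∂ν) * ρ x)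
          + ENNReal.ofReal l * (ENNReal.ofReal (b x ^ 2) * ρ x)
        = (2 * (∫⁻ t, (Iio (b x)).indicator (1 : ℝ → ℝ≥0∞) t * ENNReal.ofReal (c - l * t) ∂ν)
            + ENNReal.ofReal l * ENNReal.ofReal (b x ^ 2)) * ρ x := by ring
      _ = (2 * ENNReal.ofReal c * ENNReal.ofReal (b x)
            + ENNReal.ofReal l * ENNReal.ofReal (max (b x - c / l) 0 ^ 2)) * ρ x := by rw [h]
      _ = 2 * ENNReal.ofReal c * (ENNReal.ofReal (b x) * ρ x)
          + ENNReal.ofReal l * (ENNReal.ofReal (max (b x - c / l) 0 ^ 2) * ρ x) := by ring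
  -- Step D (exact): one square under `ν`
  have hD : (∫⁻ t, (∫⁻ x, (Iio (b x)).indicator (1 : ℝ → ℝ≥0∞) t * ρ x ∂μ)
          * (∫⁻ x, (Iio (b x)).indicator (1 : ℝ → ℝ≥0∞) t * ρ x ∂μ) ∂ν)
        + ∫⁻ t, ENNReal.ofReal (c - l * t) * ENNReal.ofReal (c - l * t) ∂ν
      = 2 * (∫⁻ t, (∫⁻ x, (Iio (b x)).indicator (1 : ℝ → ℝ≥0∞) t * ρ x ∂μ)
            * ENNReal.ofReal (c - l * t) ∂ν)
        + ∫⁻ t, (((∫⁻ x, (Iio (b x)).indicator (1 : ℝ → ℝ≥0∞) t * ρ x ∂μ)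
              - ENNReal.ofReal (c - l * t)) ^ 2
            + (ENNReal.ofReal (c - l * t)
              - ∫⁻ x, (Iio (b x)).indicator (1 : ℝ → ℝ≥0∞) t * ρ x ∂μ) ^ 2) ∂ν := by
    rw [← lintegral_add_left (hS.fun_mul hS), ← lintegral_const_mul _ (hS.fun_mul hg),
      ← lintegral_add_left ((hS.fun_mul hg).const_mul _)]
    exact lintegral_congr fun t => sq_add_sq_eq_two_mul_add _ _
  -- assemble
  calc (∫⁻ x, ∫⁻ y, ENNReal.ofReal (min (b x) (b y)) * ρ x * ρ y ∂μ ∂μ)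
        + ENNReal.ofReal (c ^ 3 / (3 * l))
        + ENNReal.ofReal l * (∫⁻ x, ENNReal.ofReal (b x ^ 2) * ρ x ∂μ)
      = ((∫⁻ t, (∫⁻ x, (Iio (b x)).indicator (1 : ℝ → ℝ≥0∞) t * ρ x ∂μ)
            * (∫⁻ x, (Iio (b x)).indicator (1 : ℝ → ℝ≥0∞) t * ρ x ∂μ) ∂ν)
          + ∫⁻ t, ENNReal.ofReal (c - l * t) * ENNReal.ofReal (c - l * t) ∂ν)
        + ENNReal.ofReal l * (∫⁻ x, ENNReal.ofReal (b x ^ 2) * ρ x ∂μ) := by rw [hA, hgg]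
    _ = 2 * (∫⁻ t, (∫⁻ x, (Iio (b x)).indicator (1 : ℝ → ℝ≥0∞) t * ρ x ∂μ)
            * ENNReal.ofReal (c - l * t) ∂ν)
        + ENNReal.ofReal l * (∫⁻ x, ENNReal.ofReal (b x ^ 2) * ρ x ∂μ)
        + ∫⁻ t, (((∫⁻ x, (Iio (b x)).indicator (1 : ℝ → ℝ≥0∞) t * ρ x ∂μ)
              - ENNReal.ofReal (c - l * t)) ^ 2
            + (ENNReal.ofReal (c - l * t)
              - ∫⁻ x, (Iio (b x)).indicator (1 : ℝ → ℝ≥0∞) t * ρ x ∂μ) ^ 2) ∂ν := by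
        rw [hD]; ring
    _ = 2 * (∫⁻ x, (∫⁻ t, (Iio (b x)).indicator (1 : ℝ → ℝ≥0∞) t * ENNReal.ofReal (c - l * t) ∂ν)
            * ρ x ∂μ)
        + ENNReal.ofReal l * (∫⁻ x, ENNReal.ofReal (b x ^ 2) * ρ x ∂μ)
        + ∫⁻ t, (((∫⁻ x, (Iio (b x)).indicator (1 : ℝ → ℝ≥0∞) t * ρ x ∂μ)
              - ENNReal.ofReal (c - l * t)) ^ 2
            + (ENNReal.ofReal (c - l * t)
              - ∫⁻ x, (Iio (b x)).indicator (1 : ℝ → ℝ≥0∞) t * ρ x ∂μ) ^ 2) ∂ν := by rw [hB]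
    _ = _ := by rw [hC]

/-- **THE EXACT EXCESS AT THE OPTIMAL TENT.**  If `Z = ∫ bρ` and `W = ∫ b²ρ` are finite and
positive, then with `c = 4Z²/(3W)`, `l = 8Z³/(9W²)` (so `c/l = 3W/(2Z)`):
`∫∫ min(b, b′)ρρ′ = (8/9)·Z³/W + l·∫ (b − 3W/(2Z))₊² ρ + ∫ ((S ∸ g)² + (g ∸ S)²) dν` — Part I's
`ofReal_eight_ninths_le_overlap` with its slack made explicit. [ours] -/
theorem overlap_eq_eight_ninths_add_excess (hb : Measurable b) (hb0 : ∀ x, 0 ≤ b x)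
    (hρ : Measurable ρ) {Z W : ℝ} (hZ : 0 < Z) (hW : 0 < W)
    (hm1 : ∫⁻ x, ENNReal.ofReal (b x) * ρ x ∂μ = ENNReal.ofReal Z)
    (hm2 : ∫⁻ x, ENNReal.ofReal (b x ^ 2) * ρ x ∂μ = ENNReal.ofReal W) :
    ∫⁻ x, ∫⁻ y, ENNReal.ofReal (min (b x) (b y)) * ρ x * ρ y ∂μ ∂μ
      = ENNReal.ofReal (8 * Z ^ 3 / (9 * W))
        + ENNReal.ofReal (8 * Z ^ 3 / (9 * W ^ 2))
          * (∫⁻ x, ENNReal.ofReal (max (b x - 3 * W / (2 * Z)) 0 ^ 2) * ρ x ∂μ)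
        + ∫⁻ t, (((∫⁻ x, (Iio (b x)).indicator (1 : ℝ → ℝ≥0∞) t * ρ x ∂μ)
              - ENNReal.ofReal (4 * Z ^ 2 / (3 * W) - 8 * Z ^ 3 / (9 * W ^ 2) * t)) ^ 2
            + (ENNReal.ofReal (4 * Z ^ 2 / (3 * W) - 8 * Z ^ 3 / (9 * W ^ 2) * t)
              - ∫⁻ x, (Iio (b x)).indicator (1 : ℝ → ℝ≥0∞) t * ρ x ∂μ) ^ 2)
            ∂(volume.restrict (Ioi 0)) := by
  have h := overlap_add_eq_deficits (μ := μ) hb hb0 hρ (c := 4 * Z ^ 2 / (3 * W))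
    (l := 8 * Z ^ 3 / (9 * W ^ 2)) (by positivity) (by positivity)
  have hcl : 4 * Z ^ 2 / (3 * W) / (8 * Z ^ 3 / (9 * W ^ 2)) = 3 * W / (2 * Z) := by
    field_simp
    ring
  rw [hm1, hm2, hcl] at h
  -- real arithmetic at the optimal tent: `2cZ = (8/9)Z³/W + c³/(3l) + lW`
  have e1 : 2 * ENNReal.ofReal (4 * Z ^ 2 / (3 * W)) * ENNReal.ofReal Z
      = ENNReal.ofReal (8 * Z ^ 3 / (9 * W))
        + (ENNReal.ofReal ((4 * Z ^ 2 / (3 * W)) ^ 3 / (3 * (8 * Z ^ 3 / (9 * W ^ 2))))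
          + ENNReal.ofReal (8 * Z ^ 3 / (9 * W ^ 2)) * ENNReal.ofReal W) := by
    rw [show (2 : ℝ≥0∞) = ENNReal.ofReal 2 by norm_num,
      ← ENNReal.ofReal_mul (by norm_num : (0:ℝ) ≤ 2), ← ENNReal.ofReal_mul (by positivity),
      ← ENNReal.ofReal_mul (by positivity), ← ENNReal.ofReal_add (by positivity) (by positivity),
      ← ENNReal.ofReal_add (by positivity) (by positivity)]
    congr 1
    field_simp
    ring
  have hK : ENNReal.ofReal ((4 * Z ^ 2 / (3 * W)) ^ 3 / (3 * (8 * Z ^ 3 / (9 * W ^ 2))))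
      + ENNReal.ofReal (8 * Z ^ 3 / (9 * W ^ 2)) * ENNReal.ofReal W ≠ ⊤ :=
    ENNReal.add_ne_top.2 ⟨ENNReal.ofReal_ne_top, ENNReal.mul_ne_top ENNReal.ofReal_ne_top
      ENNReal.ofReal_ne_top⟩
  refine (ENNReal.add_left_inj hK).1 ?_
  calc (∫⁻ x, ∫⁻ y, ENNReal.ofReal (min (b x) (b y)) * ρ x * ρ y ∂μ ∂μ)
        + (ENNReal.ofReal ((4 * Z ^ 2 / (3 * W)) ^ 3 / (3 * (8 * Z ^ 3 / (9 * W ^ 2))))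
          + ENNReal.ofReal (8 * Z ^ 3 / (9 * W ^ 2)) * ENNReal.ofReal W)
      = (∫⁻ x, ∫⁻ y, ENNReal.ofReal (min (b x) (b y)) * ρ x * ρ y ∂μ ∂μ)
        + ENNReal.ofReal ((4 * Z ^ 2 / (3 * W)) ^ 3 / (3 * (8 * Z ^ 3 / (9 * W ^ 2))))
        + ENNReal.ofReal (8 * Z ^ 3 / (9 * W ^ 2)) * ENNReal.ofReal W := (add_assoc _ _ _).symm
    _ = _ := h
    _ = _ := by rw [e1]; ring

end Core

end Summit.Ventures.LatticeQCDFlow.Theory2
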